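import Mathlib.Algebra.MonoidAlgebra.Basic
import Mathlib.RingTheory.Adjoin.Basic
import Mathlib.Tactic
import HarnessLib

/-!
# Toric surface programme: reduction of the cone parameter `a` modulo `r` (`TA[r,a] ≅ TA[r, a % r]`)

Support file for crux stmt-ResolutionOfSingularities-15317 (`FrobeniusLadder.FRationalResolution`),
line `redirect`, lead c4 (toric surface programme: all affine toric surfaces
`U(r,a) = Spec k[{m ∈ ℤ² : 0 ≤ m₂, a m₂ ≤ r m₁}]` over every field are resolved by the
Hirzebruch–Jung tower, proved for the normal form `a < r`; this file removes that normalisation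
by a unimodular change of lattice coordinates).

With `q := a / r` (ℕ-division) the lattice automorphism `θ(m₁, m₂) = (m₁ − q m₂, m₂)` of `ℤ²`
(inverse `(n₁, n₂) ↦ (n₁ + q n₂, n₂)`, determinant `1`) maps the dual-cone lattice points
`σS[r, a] = {0 ≤ m₂, a m₂ ≤ r m₁}` bijectively onto `σS[r, a % r]`: the condition `0 ≤ m₂` is
unchanged and `a m₂ ≤ r m₁ ⇔ (a − r q) m₂ ≤ r (m₁ − q m₂)` with `a − r q = a % r`
(`Nat.mod_add_div`, cast to `ℤ`). Hence the induced `k`-algebra automorphism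
`Θ = AddMonoidAlgebra.domCongr k k θ` of the torus algebra `Lk = k[ℤ²]` (`Θ χᵐ = χ^(θ m)`,
`AddMonoidAlgebra.domCongr_single`) satisfies `Subalgebra.map Θ TA[r, a] = TA[r, a % r]`
(`AlgHom.map_adjoin`, `Set.image_image`, two inclusions of lattice-point sets), and the required
`k`-algebra isomorphism is `Θ` restricted to `TA[r, a]` (`AlgEquiv.subalgebraMap`) composed with
`Subalgebra.equivOfEq`. The hypothesis `1 ≤ r` is not needed (`a % 0 = a`).

* `toric_reduce_mod_cast` — `(a % r) + r (a / r) = a` in `ℤ`;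
* `toric_reduce_mod_mem` / `toric_reduce_mod_symm_mem` — `θ` maps `σS[r, a]` into `σS[r, a % r]`
  and `θ⁻¹` maps `σS[r, a % r]` into `σS[r, a]`;
* `toric_reduce_mod_map` — `Subalgebra.map Θ TA[r, a] = TA[r, a % r]` for some torus-algebra
  automorphism `Θ` with `Θ χᵐ = χ^(θ m)`;
* `stub_toric_reduce_mod` — the registered stub.

All folklore (Cox–Little–Schenck 2011 §10.1; Fulton 1993 §2.2); no published fact is used.
-/

-- single-problem summit: the doubled namespace component is forced
set_option linter.dupNamespace false

noncomputable section

namespace Summit.ResolutionOfSingularities.ResolutionOfSingularities.Theorems.FRationalResolution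

section Toric

variable (k : Type) [Field k]

/-- The Laurent polynomial ring `k[ℤ²]` (coordinate ring of the 2-torus). -/
local notation3 "Lk" => AddMonoidAlgebra k (ℤ × ℤ)

/-- The lattice points of the dual cone `σ∨ = {m₂ ≥ 0, a m₂ ≤ r m₁}` of `σ = cone((0,1),(r,-a))`. -/
local notation3 "σS[" r ", " a "]" =>
  {m : ℤ × ℤ | 0 ≤ m.2 ∧ ((a : ℕ) : ℤ) * m.2 ≤ ((r : ℕ) : ℤ) * m.1}

/-- The toric surface algebra `k[σ∨ ∩ ℤ²] ⊆ k[ℤ²]`. -/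
local notation3 "TA[" r ", " a "]" =>
  Algebra.adjoin k ((fun m : ℤ × ℤ => AddMonoidAlgebra.single m (1 : k)) '' σS[r, a])

/-- The division identity `(a % r) + r · (a / r) = a` (ℕ-operations), cast to `ℤ`;
valid for every `r`, including `r = 0`. [folklore] -/
theorem toric_reduce_mod_cast (r a : ℕ) :
    ((a % r : ℕ) : ℤ) + ((r : ℕ) : ℤ) * ((a / r : ℕ) : ℤ) = ((a : ℕ) : ℤ) := by
  exact_mod_cast Nat.mod_add_div a r

/-- `θ(m) = (m₁ − q m₂, m₂)` (`q = a / r`) maps `σS[r, a] = {0 ≤ m₂, a m₂ ≤ r m₁}` into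
`σS[r, a % r] = {0 ≤ m₂, (a % r) m₂ ≤ r m₁}`:
`(a % r) m₂ = (a − r q) m₂ ≤ r m₁ − r q m₂ = r (m₁ − q m₂)`. [folklore] -/
theorem toric_reduce_mod_mem (r a : ℕ) (m : ℤ × ℤ)
    (hm : 0 ≤ m.2 ∧ ((a : ℕ) : ℤ) * m.2 ≤ ((r : ℕ) : ℤ) * m.1) :
    0 ≤ (m.1 - ((a / r : ℕ) : ℤ) * m.2, m.2).2 ∧
      ((a % r : ℕ) : ℤ) * (m.1 - ((a / r : ℕ) : ℤ) * m.2, m.2).2 ≤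
        ((r : ℕ) : ℤ) * (m.1 - ((a / r : ℕ) : ℤ) * m.2, m.2).1 := by
  have h := toric_reduce_mod_cast r a
  refine ⟨hm.1, ?_⟩
  dsimp only
  linear_combination hm.2 + m.2 * h

/-- `θ⁻¹(n) = (n₁ + q n₂, n₂)` (`q = a / r`) maps `σS[r, a % r] = {0 ≤ n₂, (a % r) n₂ ≤ r n₁}`
into `σS[r, a] = {0 ≤ n₂, a n₂ ≤ r n₁}`:
`a n₂ = (a % r + r q) n₂ ≤ r n₁ + r q n₂ = r (n₁ + q n₂)`. [folklore] -/
theorem toric_reduce_mod_symm_mem (r a : ℕ) (n : ℤ × ℤ)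
    (hn : 0 ≤ n.2 ∧ ((a % r : ℕ) : ℤ) * n.2 ≤ ((r : ℕ) : ℤ) * n.1) :
    0 ≤ (n.1 + ((a / r : ℕ) : ℤ) * n.2, n.2).2 ∧
      ((a : ℕ) : ℤ) * (n.1 + ((a / r : ℕ) : ℤ) * n.2, n.2).2 ≤
        ((r : ℕ) : ℤ) * (n.1 + ((a / r : ℕ) : ℤ) * n.2, n.2).1 := by
  have h := toric_reduce_mod_cast r a
  refine ⟨hn.1, ?_⟩
  dsimp only
  linear_combination hn.2 - n.2 * h

/-- The unimodular substitution `θ(m₁, m₂) = (m₁ − q m₂, m₂)` (`q = a / r`) of `ℤ²` induces a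
`k`-algebra automorphism `Θ = AddMonoidAlgebra.domCongr k k θ` of the torus algebra `Lk` with
`Θ χᵐ = χ^(θ m)`, and `Θ` carries `TA[r, a]` onto `TA[r, a % r]`. [folklore; CLS2011 §10.1] -/
theorem toric_reduce_mod_map (r a : ℕ) :
    ∃ Θ : Lk ≃ₐ[k] Lk,
      (∀ m : ℤ × ℤ, Θ (AddMonoidAlgebra.single m 1) =
        AddMonoidAlgebra.single (m.1 - ((a / r : ℕ) : ℤ) * m.2, m.2) 1) ∧
      Subalgebra.map Θ.toAlgHom TA[r, a] = TA[r, a % r] := by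
  -- the lattice automorphism `θ` with its explicit inverse
  obtain ⟨θ, hθ⟩ :
      ∃ θ : ℤ × ℤ ≃+ ℤ × ℤ, ∀ m, θ m = (m.1 - ((a / r : ℕ) : ℤ) * m.2, m.2) :=
    ⟨{ toFun := fun m => (m.1 - ((a / r : ℕ) : ℤ) * m.2, m.2)
       invFun := fun n => (n.1 + ((a / r : ℕ) : ℤ) * n.2, n.2)
       left_inv := fun m => Prod.ext (by dsimp only; ring) rfl
       right_inv := fun n => Prod.ext (by dsimp only; ring) rfl
       map_add' := fun m n =>
         Prod.ext (by dsimp only [Prod.fst_add, Prod.snd_add]; ring) rfl },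
      fun _ => rfl⟩
  refine ⟨AddMonoidAlgebra.domCongr k k θ, fun m => ?_, ?_⟩
  · rw [AddMonoidAlgebra.domCongr_single, hθ]
  · rw [AlgHom.map_adjoin, Set.image_image]
    congr 1
    ext x
    simp only [Set.mem_image, Set.mem_setOf_eq, AlgEquiv.toAlgHom_apply,
      AddMonoidAlgebra.domCongr_single]
    constructor
    · rintro ⟨m, hm, rfl⟩
      exact ⟨θ m, (hθ m).symm ▸ toric_reduce_mod_mem r a m hm, rfl⟩
    · rintro ⟨n, hn, rfl⟩
      refine ⟨(n.1 + ((a / r : ℕ) : ℤ) * n.2, n.2), toric_reduce_mod_symm_mem r a n hn, ?_⟩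
      rw [hθ]
      congr 1
      exact Prod.ext (by dsimp only; ring) rfl

/-- **Reduction of the cone parameter modulo `r`.** For `1 ≤ r` the toric surface algebras
`TA[r, a] = k[σS[r, a]]` and `TA[r, a % r]` are isomorphic as `k`-algebras: the unimodular
substitution `θ(m₁, m₂) = (m₁ − (a / r) m₂, m₂)` carries `σS[r, a]` onto `σS[r, a % r]`, so the
torus-algebra automorphism `Θ = AddMonoidAlgebra.domCongr k k θ` restricts to
`TA[r, a] ≃ₐ[k] TA[r, a % r]` (`U(r, a) ≅ U(r, a mod r)`). [folklore; CLS2011 §10.1] -/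
theorem stub_toric_reduce_mod (r a : ℕ) (hr : 1 ≤ r) :
    Nonempty (↥TA[r, a] ≃ₐ[k] ↥TA[r, a % r]) := by
  have _ := hr
  obtain ⟨Θ, -, hmap⟩ := toric_reduce_mod_map k r a
  exact ⟨(Θ.subalgebraMap TA[r, a]).trans (Subalgebra.equivOfEq _ _ hmap)⟩

end Toric

end Summit.ResolutionOfSingularities.ResolutionOfSingularities.Theorems.FRationalResolution

end
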